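import Literature.IUT.LogVolume.PacketMonomialBox
import Mathlib.RingTheory.PowerBasis
import Mathlib.RingTheory.Polynomial.Cyclotomic.Roots
import HarnessLib

/-!
# The monomial box of a tensor packet IS the normalisation `(R_I)^∼` at RADICAL tame power bases (`π_i^{e_i} ∈ ℚ_p`, `p ∤ e_i`):
# E-t58's `box_of_mem_normalizedPacket_of_incongruent` with the incongruence hypothesis REMOVED (discrete Fourier transform over `∏_i μ_{e_i} ⊂ ℚ̄_p`)

Classical local algebra (nothing disputed; the [IUTchIV] locator records where the abc-iut cell uses it).  abc-iut cell, seat abc-iut-c312-1 (gen 19;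
row «R26 = C:ROOM-SHARPNESS» item (θ3), C LEAD ruling C-R171 (a) ff.).  PROOF-ONLY sequel of abc-iut-E-t58's `PacketMonomialBox.lean`: there
`Box ⊆ (R_I)^∼` for EVERY family of slot bases (`MonomialBox.mem_normalizedPacket_of_box`) and `(R_I)^∼ ⊆ Box` when the monomial norms
`∏_i ‖b^{(i)}_{J_i}‖` are pairwise INCONGRUENT mod `p^ℤ` (one embedding family `⊗σ_i : V → ℚ̄_p` and distinct absolute values) — which fails at the
IUT shape `K_w ⊗ ⋯ ⊗ K_w` of equal ramification.  HERE: for POWER bases `b^{(i)}_j = π_i^j` (`j < e_i`) of RADICAL generators `π_i^{e_i} = a_i ∈ ℚ_p`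
with TAME exponents `p ∤ e_i`, `(R_I)^∼ ⊆ Box` holds WITHOUT incongruence:
* §1 `minpoly_eq_X_pow_sub_C` (`X^{e_i} − a_i` is the minimal polynomial: power basis of dimension `e_i`), `exists_algHom_apply_eq` — for every
  root `y` of `X^{e_i} − a_i` in `ℚ̄_p` an embedding `σ : k_i → ℚ̄_p` with `σ(π_i) = y` (Mathlib `PowerBasis.lift`); `exists_isPrimitiveRoot` in `ℚ̄_p`;
  `sum_pow_mul_eq` — the character sum `Σ_{m<e} ζ^{m·d}` is `e` if `e ∣ d` and `0` otherwise.
* §2 **`box_of_mem_normalizedPacket_of_radical`** — `z ∈ (R_I)^∼ ⟹ ‖z_J‖·∏_i ‖π_i‖^{J_i} ≤ 1` for every tensor-basis coordinate: for each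
  `κ ∈ ∏_i ℤ/e_i` the embedding family `σ_{i,κ_i} : π_i ↦ ζ_i^{κ_i}·ρ_i` gives `Φ_κ = ⊗σ_{i,κ_i} : V → ℚ̄_p` with `‖Φ_κ z‖ ≤ 1` (integrality), and
  `Σ_κ ζ^{κ·(e−J)}·Φ_κ z = (∏_i e_i)·z_J·∏_i ρ_i^{J_i}` (orthogonality of characters), `‖∏ e_i‖ = 1` (tameness), `‖ρ_i‖ = ‖π_i‖`;
  **`mem_normalizedPacket_iff_box_of_radical`** (with E-t58's §1) — `(R_I)^∼` = Box.
So at every packet of TAME RADICAL slot fields — in particular `⊗_i ℚ_p((m_i p)^{1/e_i})`, the genuine completions at tame places of residue degree one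
(radical uniformisers exist there by Hensel) — the maximal order is the valuation box of the monomials, whatever the congruences of the `e_i`.
[cite: Mochizuki2012, IUTchIV Prop. 1.1 p. 9] [cite: NeukirchANT1999, Ch. II (4.8), (5.5)] [cite: SerreLocalFields1979, Ch. I §6]
-/

noncomputable section

open Module Polynomial
open scoped Pointwise

namespace Literature.IUT.LogVolume

namespace MonomialBox

/-! ## §1 Radical generators: minimal polynomial, twisted embeddings, character sums -/

section Radical

variable (p : ℕ) [hp : Fact p.Prime]
variable {K : Type} [NontriviallyNormedField K] [NormedAlgebra ℚ_[p] K]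

/-- For a power basis `(π^j)_{j<e}` with `π^e = a ∈ ℚ_p`, the minimal polynomial of `π` is `X^e − a`. [cite: NeukirchANT1999, Ch. II (5.5)] -/
theorem minpoly_eq_X_pow_sub_C {e : ℕ} (he : 0 < e) (b : Basis (Fin e) ℚ_[p] K) {π : K} (hb : ∀ j, b j = π ^ (j : ℕ))
    {a : ℚ_[p]} (hπ : π ^ e = algebraMap ℚ_[p] K a) : minpoly ℚ_[p] π = X ^ e - C a := by
  let pb : PowerBasis ℚ_[p] K := ⟨π, e, b, hb⟩
  have hmonic : (X ^ e - C a : ℚ_[p][X]).Monic := monic_X_pow_sub_C a he.ne'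
  have hroot : aeval π (X ^ e - C a : ℚ_[p][X]) = 0 := by
    rw [map_sub, aeval_X_pow, aeval_C, hπ, sub_self]
  have hdvd : minpoly ℚ_[p] π ∣ X ^ e - C a := minpoly.dvd ℚ_[p] π hroot
  have hdeg : (minpoly ℚ_[p] π).natDegree = e := pb.natDegree_minpoly
  refine (Polynomial.eq_of_monic_of_dvd_of_natDegree_le (minpoly.monic pb.isIntegral_gen) hmonic hdvd ?_).symm
  rw [hdeg, natDegree_X_pow_sub_C]

/-- Every root `y ∈ ℚ̄_p` of `X^e − a` is the image of `π` under some embedding `k → ℚ̄_p` (`PowerBasis.lift`). [cite: NeukirchANT1999, Ch. II (4.8)] -/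
theorem exists_algHom_apply_eq {e : ℕ} (he : 0 < e) (b : Basis (Fin e) ℚ_[p] K) {π : K} (hb : ∀ j, b j = π ^ (j : ℕ))
    {a : ℚ_[p]} (hπ : π ^ e = algebraMap ℚ_[p] K a) {y : PadicAlgCl p} (hy : y ^ e = algebraMap ℚ_[p] (PadicAlgCl p) a) :
    ∃ σ : K →ₐ[ℚ_[p]] PadicAlgCl p, σ π = y := by
  let pb : PowerBasis ℚ_[p] K := ⟨π, e, b, hb⟩
  have hy' : aeval y (minpoly ℚ_[p] pb.gen) = 0 := by
    rw [show pb.gen = π from rfl, minpoly_eq_X_pow_sub_C p he b hb hπ, map_sub, aeval_X_pow, aeval_C, hy, sub_self]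
  exact ⟨pb.lift y hy', pb.lift_gen y hy'⟩

/-- `ℚ̄_p` has primitive `e`-th roots of unity for every `e ≥ 1` (a root of the cyclotomic polynomial). [folklore] -/
private theorem exists_isPrimitiveRoot {e : ℕ} (he : 0 < e) : ∃ ζ : PadicAlgCl p, IsPrimitiveRoot ζ e := by
  haveI : NeZero e := ⟨he.ne'⟩
  haveI : NeZero ((e : ℕ) : PadicAlgCl p) := NeZero.charZero
  obtain ⟨ζ, hζ⟩ := IsAlgClosed.exists_root (cyclotomic e (PadicAlgCl p)) (by
    rw [degree_cyclotomic]; exact_mod_cast (Nat.totient_pos.mpr he).ne')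
  exact ⟨ζ, (isRoot_cyclotomic_iff).mp hζ⟩

/-- **Orthogonality of characters of `ℤ/e`:** `Σ_{m<e} ζ^{m·d} = e` if `e ∣ d`, `= 0` otherwise (`ζ` a primitive `e`-th root of unity). [folklore] -/
private theorem sum_pow_mul_eq {e : ℕ} {ζ : PadicAlgCl p} (hζ : IsPrimitiveRoot ζ e) (d : ℕ) :
    ∑ m : Fin e, ζ ^ ((m : ℕ) * d) = if e ∣ d then (e : PadicAlgCl p) else 0 := by
  have hsum : ∑ m : Fin e, ζ ^ ((m : ℕ) * d) = ∑ m ∈ Finset.range e, (ζ ^ d) ^ m :=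
    calc ∑ m : Fin e, ζ ^ ((m : ℕ) * d) = ∑ m : Fin e, (ζ ^ d) ^ (m : ℕ) :=
          Finset.sum_congr rfl fun m _ => by rw [← pow_mul, mul_comm]
      _ = ∑ m ∈ Finset.range e, (ζ ^ d) ^ m := Fin.sum_univ_eq_sum_range (fun m => (ζ ^ d) ^ m) e
  rw [hsum]
  split_ifs with hd
  · rw [Finset.sum_congr rfl (fun m _ => show (ζ ^ d) ^ m = 1 by rw [(hζ.pow_eq_one_iff_dvd d).mpr hd, one_pow]),
      Finset.sum_const, Finset.card_range, nsmul_eq_mul, mul_one]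
  · have hne : ζ ^ d ≠ 1 := fun h => hd ((hζ.pow_eq_one_iff_dvd d).mp h)
    have hpow : (ζ ^ d) ^ e = 1 := by rw [← pow_mul, mul_comm, pow_mul, hζ.pow_eq_one, one_pow]
    have h0 := mul_geom_sum (ζ ^ d) e
    rw [hpow, sub_self] at h0
    -- `h0 : (ζ^d − 1) * Σ = 0`
    exact (mul_eq_zero.mp h0).resolve_left (sub_ne_zero.mpr hne)

end Radical

/-! ## §2 `(R_I)^∼ ⊆ Box` for radical tame power bases -/

section Packet

variable (p : ℕ) [hp : Fact p.Prime] {I : Type} [Fintype I] [DecidableEq I]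
  (k : I → Type) [∀ i, NontriviallyNormedField (k i)] [∀ i, NormedAlgebra ℚ_[p] (k i)]
  [∀ i, IsUltrametricDist (k i)] [∀ i, ProperSpace (k i)]
variable (e : I → ℕ) (b : ∀ i, Basis (Fin (e i)) ℚ_[p] (k i)) (π : Π i, k i) (a : I → ℚ_[p])

/-- **`(R_I)^∼ ⊆ Box` for RADICAL TAME power bases.**  Slots `k_i` with power bases `b^{(i)}_j = π_i^j` (`j < e_i`) of radical generators
`π_i^{e_i} = a_i ∈ ℚ_p` and `p ∤ e_i`.  Then every `z ∈ (R_I)^∼` has tensor-basis coordinates with `‖z_J‖·∏_i ‖b^{(i)}_{J_i}‖ ≤ 1`.  Proof: primitive roots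
`ζ_i ∈ μ_{e_i}(ℚ̄_p)`, a base embedding `ρ_i = σ_{i,0}(π_i)` and the twisted embeddings `σ_{i,m}(π_i) = ζ_i^m ρ_i` (§1); for `κ ∈ ∏_i ℤ/e_i` the algebra
map `Φ_κ = ⊗σ_{i,κ_i} : V → ℚ̄_p` has `‖Φ_κ z‖ ≤ 1` (integrality) and `Φ_κ z = Σ_{J′} z_{J′} ∏_i ζ_i^{κ_i J′_i} ρ_i^{J′_i}`; the character sum
`Σ_κ (∏_i ζ_i^{κ_i (e_i − J_i)})·Φ_κ z = (∏_i e_i)·z_J·∏_i ρ_i^{J_i}` has norm `≤ 1`, `‖∏ e_i‖ = 1`, `‖ρ_i‖ = ‖π_i‖`.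
[cite: Mochizuki2012, IUTchIV Prop. 1.1 p. 9] [cite: NeukirchANT1999, Ch. II (4.8), (5.5)] -/
theorem box_of_mem_normalizedPacket_of_radical [Nonempty I] (he0 : ∀ i, 0 < e i) (hpe : ∀ i, ¬ p ∣ e i)
    (hb : ∀ i (j : Fin (e i)), b i j = π i ^ (j : ℕ)) (hπ : ∀ i, π i ^ e i = algebraMap ℚ_[p] (k i) (a i))
    {z : PacketAlgebra p k} (hz : z ∈ normalizedPacket p k) (J : Π i, Fin (e i)) :
    ‖(Basis.piTensorProduct b).repr z J‖ * ∏ i, ‖b i (J i)‖ ≤ 1 := by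
  classical
  have hP : p.Prime := Fact.out
  -- primitive roots and the base roots `ρ_i`
  have hζex : ∀ i, ∃ ζ : PadicAlgCl p, IsPrimitiveRoot ζ (e i) := fun i => exists_isPrimitiveRoot p (he0 i)
  choose ζ hζ using hζex
  have σ₀ : ∀ i, k i →ₐ[ℚ_[p]] PadicAlgCl p := fun i => Classical.choice EmbeddingOrder.nonempty_algHom_padicAlgCl
  set ρ : Π i, PadicAlgCl p := fun i => σ₀ i (π i) with hρ
  have hρe : ∀ i, ρ i ^ e i = algebraMap ℚ_[p] (PadicAlgCl p) (a i) := fun i => by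
    rw [hρ, ← map_pow, hπ i, AlgHom.commutes]
  have hnρ : ∀ i, ‖ρ i‖ = ‖π i‖ := fun i => norm_map_algHom (σ₀ i) _
  have hnζ : ∀ i (n : ℕ), ‖ζ i ^ n‖ = 1 := fun i n => by
    have h1 : ‖ζ i‖ ^ e i = 1 := by rw [← norm_pow, (hζ i).pow_eq_one, norm_one]
    rw [norm_pow, (pow_eq_one_iff_of_nonneg (norm_nonneg _) (he0 i).ne').mp h1, one_pow]
  -- the twisted embeddings `σ i m : π_i ↦ ζ_i^m ρ_i`
  have hσex : ∀ i (m : ℕ), ∃ σ : k i →ₐ[ℚ_[p]] PadicAlgCl p, σ (π i) = ζ i ^ m * ρ i := fun i m =>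
    exists_algHom_apply_eq p (he0 i) (b i) (hb i) (hπ i) (by
      rw [mul_pow, ← pow_mul, mul_comm m, pow_mul, (hζ i).pow_eq_one, one_pow, one_mul, hρe i])
  choose σ hσ using hσex
  -- the product embeddings `Φ κ = ⊗_i σ_{i,κ_i}`
  have hΦex : ∀ κ : Π i, Fin (e i), ∃ Φ : PacketAlgebra p k →ₐ[ℚ_[p]] PadicAlgCl p,
      ∀ x : Π i, k i, Φ (purePacket p k x) = ∏ i, σ i (κ i) (x i) := fun κ => exists_algHom_of_algHom p k (fun i => σ i (κ i))
  choose Φ hΦ using hΦex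
  have hint : ∀ κ, ‖Φ κ z‖ ≤ 1 := fun κ =>
    (Literature.NumberTheory.GaloisRepresentations.PadicAlgCl.norm_le_one_iff_isIntegral _).mpr
      ((isIntegral_of_mem_normalizedPacket p k hz).map ((Φ κ).restrictScalars ℤ_[p]))
  -- coordinates and the expansion of `Φ κ z`
  set c : (Π i, Fin (e i)) → ℚ_[p] := fun J' => (Basis.piTensorProduct b).repr z J' with hc
  have hexp : ∀ κ, Φ κ z = ∑ J', c J' • ∏ i, (ζ i ^ ((κ i : ℕ) * (J' i : ℕ)) * ρ i ^ (J' i : ℕ)) := by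
    intro κ
    conv_lhs => rw [← (Basis.piTensorProduct b).sum_repr z]
    rw [map_sum]
    refine Finset.sum_congr rfl fun J' _ => ?_
    rw [map_smul, Basis.piTensorProduct_apply, ← purePacket, hΦ]
    congr 1
    refine Finset.prod_congr rfl fun i _ => ?_
    rw [hb, map_pow, hσ, mul_pow, ← pow_mul]
  -- the character sum
  set χ : (Π i, Fin (e i)) → PadicAlgCl p := fun κ => ∏ i, ζ i ^ ((κ i : ℕ) * (e i - (J i : ℕ))) with hχ
  have hnχ : ∀ κ, ‖χ κ‖ = 1 := fun κ => by
    rw [hχ, norm_prod, Finset.prod_eq_one fun i _ => hnζ i _]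
  set S : PadicAlgCl p := ∑ κ, χ κ * Φ κ z with hS
  have hSle : ‖S‖ ≤ 1 := by
    refine IsUltrametricDist.norm_sum_le_of_forall_le_of_nonneg zero_le_one fun κ _ => ?_
    rw [norm_mul, hnχ, one_mul]; exact hint κ
  -- evaluation: `S = (∏ e_i) · c_J · ∏ ρ_i^{J_i}`
  have hinner : ∀ J' : Π i, Fin (e i),
      ∑ κ : Π i, Fin (e i), χ κ * ∏ i, (ζ i ^ ((κ i : ℕ) * (J' i : ℕ)) * ρ i ^ (J' i : ℕ)) =
        (∏ i, ρ i ^ (J' i : ℕ)) * ∏ i, ∑ m : Fin (e i), ζ i ^ ((m : ℕ) * (e i - (J i : ℕ) + (J' i : ℕ))) := by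
    intro J'
    rw [Finset.prod_univ_sum, Finset.mul_sum]
    simp only [Fintype.piFinset_univ]
    refine Finset.sum_congr rfl fun κ _ => ?_
    simp only [hχ]
    rw [← Finset.prod_mul_distrib, ← Finset.prod_mul_distrib]
    refine Finset.prod_congr rfl fun i _ => ?_
    rw [mul_add, pow_add]
    ring
  have hchar : ∀ J' : Π i, Fin (e i), ∀ i,
      ∑ m : Fin (e i), ζ i ^ ((m : ℕ) * (e i - (J i : ℕ) + (J' i : ℕ))) = if J' i = J i then (e i : PadicAlgCl p) else 0 := by
    intro J' i
    rw [sum_pow_mul_eq p (hζ i)]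
    have hJ : (J i : ℕ) < e i := (J i).isLt
    have hJ' : (J' i : ℕ) < e i := (J' i).isLt
    by_cases h : J' i = J i
    · rw [if_pos h, if_pos]
      rw [h]; exact ⟨1, by omega⟩
    · rw [if_neg h, if_neg]
      rintro ⟨q, hq⟩
      have hne : (J' i : ℕ) ≠ (J i : ℕ) := fun hh => h (Fin.ext hh)
      rcases Nat.lt_or_ge q 1 with hq0 | hq1
      · have : q = 0 := by omega
        rw [this, mul_zero] at hq; omega
      · rcases Nat.lt_or_ge q 2 with hq2 | hq2
        · have : q = 1 := by omega
          rw [this, mul_one] at hq; omega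
        · have : e i * 2 ≤ e i * q := Nat.mul_le_mul_left _ hq2
          omega
  have hSeval : S = (∏ i, (e i : PadicAlgCl p)) * (c J • ∏ i, ρ i ^ (J i : ℕ)) := by
    rw [hS, Finset.sum_congr rfl (fun κ _ => by rw [hexp κ, Finset.mul_sum]), Finset.sum_comm]
    have hterm : ∀ J' : Π i, Fin (e i), ∑ κ : Π i, Fin (e i), χ κ * (c J' • ∏ i, (ζ i ^ ((κ i : ℕ) * (J' i : ℕ)) * ρ i ^ (J' i : ℕ))) =
        c J' • ((∏ i, ρ i ^ (J' i : ℕ)) * ∏ i, (if J' i = J i then (e i : PadicAlgCl p) else 0)) := by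
      intro J'
      rw [← Finset.prod_congr rfl (fun i _ => hchar J' i), ← hinner J', Finset.smul_sum]
      refine Finset.sum_congr rfl fun κ _ => ?_
      rw [mul_smul_comm]
    rw [Finset.sum_congr rfl (fun J' _ => hterm J'), Finset.sum_eq_single J]
    · rw [Finset.prod_congr rfl (fun i _ => if_pos rfl), mul_smul_comm]
      congr 1
      exact mul_comm _ _
    · intro J' _ hJ'
      obtain ⟨i, hi⟩ : ∃ i, J' i ≠ J i := by
        by_contra hall; push Not at hall; exact hJ' (funext hall)
      have h0 : (∏ i, (if J' i = J i then (e i : PadicAlgCl p) else 0)) = 0 :=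
        Finset.prod_eq_zero (Finset.mem_univ i) (if_neg hi)
      rw [h0, mul_zero, smul_zero]
    · intro hJ; exact absurd (Finset.mem_univ J) hJ
  -- norms
  have hne : ‖∏ i, (e i : PadicAlgCl p)‖ = 1 := by
    rw [norm_prod, Finset.prod_eq_one]
    intro i _
    rw [show ((e i : ℕ) : PadicAlgCl p) = algebraMap ℚ_[p] (PadicAlgCl p) (e i : ℚ_[p]) from (map_natCast _ _).symm, norm_algebraMap']
    refine le_antisymm ?_ (not_lt.mp fun hlt => hpe i ((Padic.norm_natCast_lt_one_iff).mp hlt))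
    exact_mod_cast Padic.norm_int_le_one (p := p) (e i : ℤ)
  have hval : ‖S‖ = ‖c J‖ * ∏ i, ‖b i (J i)‖ := by
    rw [hSeval, norm_mul, hne, one_mul, norm_smul, norm_prod]
    congr 1
    refine Finset.prod_congr rfl fun i _ => ?_
    rw [norm_pow, hnρ, hb, norm_pow]
  change ‖c J‖ * ∏ i, ‖b i (J i)‖ ≤ 1
  rw [← hval]
  exact hSle

/-- **`(R_I)^∼` = Box at radical tame power bases:** membership in the normalised packet is the coordinate condition
`‖z_J‖·∏_i ‖π_i‖^{J_i} ≤ 1 ∀J` (§2 + E-t58's `mem_normalizedPacket_of_box`). [cite: Mochizuki2012, IUTchIV Prop. 1.1 p. 9] -/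
theorem mem_normalizedPacket_iff_box_of_radical [Nonempty I] (he0 : ∀ i, 0 < e i) (hpe : ∀ i, ¬ p ∣ e i)
    (hb : ∀ i (j : Fin (e i)), b i j = π i ^ (j : ℕ)) (hπ : ∀ i, π i ^ e i = algebraMap ℚ_[p] (k i) (a i))
    (z : PacketAlgebra p k) :
    z ∈ normalizedPacket p k ↔ ∀ J : Π i, Fin (e i), ‖(Basis.piTensorProduct b).repr z J‖ * ∏ i, ‖b i (J i)‖ ≤ 1 :=
  ⟨fun hz => box_of_mem_normalizedPacket_of_radical p k e b π a he0 hpe hb hπ hz, mem_normalizedPacket_of_box p k b⟩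

end Packet

end MonomialBox

end Literature.IUT.LogVolume
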